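import Summits.BirchSwinnertonDyer.Rank1Residual.Supersingular.X7VisibilityRecordsC1
import Summits.BirchSwinnertonDyer.Rank1Residual.Supersingular.RankOneRem13NoCertificate
import Literature.NumberTheory.EllipticCurves.Fisher2012.HesseFamilyFiveIndClosedForms
import Literature.NumberTheory.EllipticCurves.Rank1Residual.Typed.X7
import Summits.BirchSwinnertonDyer.Rank1Residual.Supersingular.RankZeroSurjCertificatesX7_19
import HarnessLib

/-!
# N5 (X7 ∧ r_an = 0, p ≥ 5) by VISIBILITY — per-pair `BSD(E,p)` for cells WITHOUT any per-pair theorem of record, from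
# `p`-congruent RANK-2 Cremona partners (DB-partner census kit j156242), Wuthrich's upper bound, Cassels–Tate and the refined count

Cell `b2b-bsdres`, supersingular family, prover A = unit `b2b-bsdres-x10b` (gen 15), X7 joint pair A side.  Topic file;
namespace `Summit.BirchSwinnertonDyer.Rank1Residual.Supersingular`.  THEOREMS ONLY; no named fact, no definition,
nothing booked; X7 stays CONSTRUCTION-SHAPED (mark of RESIDUAL-MAP §I N5 unchanged).  Method and the X6 shape:
`X6VisibilityTamDefectShape.lean`; census: for every Cremona curve `F` of rank `≥ 2` (358 160 of them) and every open N4/N5 cell `(E,p)`,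
`p ≥ 5` (605), the mod-`p` trace congruence (hash on 8 primes `≥ 1009`, then all good `ℓ ≤ 3000`), the refined count, the independence of
`F`'s points in `F(ℚ)/pF(ℚ)` (reduction functionals) and, at `p = 5`, the location of `F` in Fisher's families `X_E(5)` / `X_E⁻(5)`
(kernel congruence certificate): 153 cells get a certified partner, 7 of them N5 cells with NO per-pair theorem of record
(`HOME/b2b-bsdres-x10b/X6-KURIHARA.md` §18).  Cells in this file: 411840jx1.

HONEST FRAMING (run/shared/lean/b2b/bsd-rank1-residual/, verbatim in every file): the goal of the cell is to
DELETE the COMBINATION-SHAPED residual classes of the Birch–Swinnerton-Dyer formula for ALL analytic-rank `≤ 1`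
elliptic curves over `ℚ` — "full BSD formula for every rank `≤ 1` curve in class `C`" assembled STRICTLY from
published theorems — so that the rank-`≤ 1` remainder becomes exactly the CONSTRUCTION-SHAPED classes, which are
TYPED (missing-input `Prop`s), NOT attempted.  This is not "finishing BSD".

References: Cremona–Mazur 2000 §3 [CremonaMazur2000]; Fisher 2016 Thm. 4.4 [Fisher2016Visualizing7]; Fisher 2012
Thm. 13.2 [Fisher2012Hessian]; Wuthrich 2014 Prop. 21 [Wuthrich2014]; Silverman AEC VII.5.1, X.4.14
[SilvermanAEC2009]; ATAEC V [SilvermanATAEC1994]; Cremona's tables [Cremona2006]; HOME/b2b-bsdres-x10b/X6-KURIHARA.md §18.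
-/

set_option autoImplicit false

noncomputable section

open scoped Classical

open WeierstrassCurve Literature.NumberTheory.EllipticCurves
  Literature.NumberTheory.EllipticCurves.Rank1Residual
  Literature.NumberTheory.EllipticCurves.Rank1Residual.Typed
  Literature.NumberTheory.EllipticCurves.Rank1Residual.X11RankOneCertificates
  Literature.NumberTheory.EllipticCurves.Wuthrich2014
  Literature.NumberTheory.EllipticCurves.Fisher2016
  Literature.NumberTheory.EllipticCurves.Fisher2012
  Summit.BirchSwinnertonDyer.BirchSwinnertonDyer.Rank1Residual.IntModel
  Summit.BirchSwinnertonDyer.Rank1Residual.X11b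
open NumberField IsDedekindDomain Rat.HeightOneSpectrum

namespace Summit.BirchSwinnertonDyer.Rank1Residual.Supersingular


/-! ### `411840jx1 @ 7` (X7 ∧ `r_an = 0`, `#Ш_an = 7²`, `∏c` prime to `7`) ← `411840ke1` (Cremona, rank 2, conductor `411840`) -/

/-- `411840jx1` (Cremona's minimal model) is an elliptic curve. [cite: Cremona2006, Table 1 (Cremona label 411840jx1)] -/
theorem isElliptic_c411840jx1 : (⟨0, 0, 0, 29720688, -180946909024⟩ : WeierstrassCurve ℚ).IsElliptic :=
  isElliptic_of_discOf_ne_zero 0 0 0 29720688 (-180946909024) (by decide +kernel)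

/-- `411840jx1` is globally minimal (Kraus' bounded criterion, kernel). [cite: SilvermanAEC2009, VII.1 Remark 1.1] -/
theorem isGloballyMinimal_c411840jx1 : (⟨0, 0, 0, 29720688, -180946909024⟩ : WeierstrassCurve ℚ).IsGloballyMinimal :=
  isGloballyMinimal_of_krausCriterion_bounded₂ 0 0 0 29720688 (-180946909024) (by decide +kernel) (by decide +kernel) (by decide +kernel)

/-- `411840ke1` (Cremona's minimal model) is an elliptic curve. [cite: Cremona2006, Table 1 (Cremona label 411840ke1)] -/
theorem isElliptic_c411840ke1 : (⟨0, 0, 0, -659532, 206652656⟩ : WeierstrassCurve ℚ).IsElliptic :=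
  isElliptic_of_discOf_ne_zero 0 0 0 (-659532) 206652656 (by decide +kernel)

/-- `#Ẽ(𝔽_7) = 8` for `411840jx1` (`a_7 = 0`: good SUPERSINGULAR at `7`; kernel count). [folklore] -/
theorem card_c411840jx1_7 :
    Nat.card (((⟨0, 0, 0, 29720688, -180946909024⟩ : WeierstrassCurve ℤ).map (Int.castRingHom (ZMod 7))).toAffine.Point) = 8 :=
  haveI : Fact (Nat.Prime 7) := ⟨by norm_num⟩
  natCard_point_eq_of_countPoints 0 0 0 29720688 (-180946909024) 7 (by norm_num) (by decide +kernel) (by decide +kernel)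

/-- **`BSD(E,7)` for `411840jx1`** (N5 cell WITHOUT a per-pair theorem so far: class X7, good supersingular at `7`, additive at
`2`, `r_an = 0`, `#Ш_an = 7²`) from PUBLISHED theorems — Cassels–Tate (`hCT`), Wuthrich 2014 Prop. 21 (`hW`), GZK (`hGZK`),
modularity (`hmod`), Tate uniformisation (`hU`, `hU2`) — and a VISIBLE element of `Ш(E)[7]` explained by the `7`-CONGRUENT RANK-2
curve `F = 411840ke1` (Cremona; points `(712, 9900)`, `(437, 1375)` independent in `F(ℚ)/7F(ℚ)` by reduction functionals at `101, 107`;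
DB-partner census kit j156242, `a_ℓ(E) ≡ a_ℓ(F) (mod 7)` at every good `ℓ ≤ 3000`).  Places (E/F): `2` additive/additive; `3` additive/additive; `5` split/split; `7` good/good; `11` nonsplit/nonsplit; `13` split/split.  Count: every
place of `S` other than `7` is of kind (i) (`#F(ℚ_v)[7] = 1`, binders `h…`; additive or non-split-with-`v ≢ −1` or split-with-
`7 ∤ ord_v Δ_F` places, two engines: PARI `factorpadic` of `ψ_7` + the structure rules), pay `7·#F(ℚ_7)[7] = 7 < 49 ≤ 7^{rank F}`
at `7`.  KERNEL: minimality of `E`, `ClassX7 E 7` (`classX7_of_intModel`, additive prime `2`), `surj(7)` (B's `surj_x7r0_411840jx1_7`),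
good reduction of both curves off `S` (discriminant supports), `7 ∤ #E(ℚ)`.  Displayed binders: `θ` (`hθ`), `rank F ≥ 2` (`hrank`), the
local counts, `r_an = 0`, `ord_7 #Ш_an ≤ 2`.  Per pair (an OFFER for referee A); NOT a class theorem; nothing booked.
[cite: Wuthrich2014, Prop. 21 (p. 400)] [cite: CremonaMazur2000, §3 and Table 1] [cite: SilvermanAEC2009, VII.5 Prop. 5.1 and Thm. X.4.14]
[cite: Cremona2006, Table 1 (Cremona labels 411840jx1, 411840ke1)] -/
theorem bsdp_x7r0vis_411840jx1_7_of_congr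
    (hCT : exists_casselsTate_pairing (K := ℚ)) (hW : sha_dvd_analyticSha)
    (hGZK : rank_eq_analyticRank_of_analyticRank_le_one) (hmod : hasEntireLFunction_rat)
    (hU : Silverman1994_thmV53_tateUniformisation.{0})
    (hU2 : Silverman1994_thmV53_corV54_tateUniformisation.{0})
    {W F : WeierstrassCurve ℚ} [W.IsElliptic] [W.IsGloballyMinimal] [F.IsElliptic]
    (hWeq : W = ⟨0, 0, 0, 29720688, -180946909024⟩) (hFeq : F = ⟨0, 0, 0, -659532, 206652656⟩)
    (hr0 : W.analyticRank = 0) {q : ℚ} (hq : shaAn W = (q : ℂ)) (hv : padicValRat 7 q ≤ 2)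
    (θ : geomTorsion F (7 : ℤ) ≃+ geomTorsion W (7 : ℤ))
    (hθ : ∀ (σ : Field.absoluteGaloisGroup ℚ) (P : geomTorsion F (7 : ℤ)), θ (σ • P) = σ • θ P)
    (hrank : 2 ≤ F.mordellWeilRank)
    (h2 : ∀ w : HeightOneSpectrum (𝓞 ℚ), (primesEquiv w : ℕ) = 2 →
      Nat.card (nsmulAddMonoidHom 7 : (F.baseChange (w.adicCompletion ℚ)).toAffine.Point →+ _).ker = 1)
    (h3 : ∀ w : HeightOneSpectrum (𝓞 ℚ), (primesEquiv w : ℕ) = 3 →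
      Nat.card (nsmulAddMonoidHom 7 : (F.baseChange (w.adicCompletion ℚ)).toAffine.Point →+ _).ker = 1)
    (h5 : ∀ w : HeightOneSpectrum (𝓞 ℚ), (primesEquiv w : ℕ) = 5 →
      Nat.card (nsmulAddMonoidHom 7 : (F.baseChange (w.adicCompletion ℚ)).toAffine.Point →+ _).ker = 1)
    (h7 : ∀ w : HeightOneSpectrum (𝓞 ℚ), (primesEquiv w : ℕ) = 7 →
      Nat.card (nsmulAddMonoidHom 7 : (F.baseChange (w.adicCompletion ℚ)).toAffine.Point →+ _).ker = 1)
    (h11 : ∀ w : HeightOneSpectrum (𝓞 ℚ), (primesEquiv w : ℕ) = 11 →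
      Nat.card (nsmulAddMonoidHom 7 : (F.baseChange (w.adicCompletion ℚ)).toAffine.Point →+ _).ker = 1)
    (h13 : ∀ w : HeightOneSpectrum (𝓞 ℚ), (primesEquiv w : ℕ) = 13 →
      Nat.card (nsmulAddMonoidHom 7 : (F.baseChange (w.adicCompletion ℚ)).toAffine.Point →+ _).ker = 1)
    : BSDp W 7 := by
  haveI : Fact (Nat.Prime 7) := ⟨by norm_num⟩
  have hIW : integralModelInt W = ⟨0, 0, 0, 29720688, -180946909024⟩ :=
    integralModelInt_eq_of_map_eq _ (by rw [hWeq]; ext <;> simp [WeierstrassCurve.map])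
  have hX : ClassX7 W 7 :=
    classX7_of_intModel 7 hIW (by decide +kernel) card_c411840jx1_7 (by decide) 2 (by norm_num) (by decide +kernel)
      (by decide +kernel)
  have hs : Surj W 7 := (by rw [hWeq]; exact surj_x7r0_411840jx1_7)
  set L : List ℕ := [2, 3, 5, 7, 11, 13] with hL
  have hLp : ∀ q ∈ L, q.Prime := by decide
  have hΔE : ∀ q : ℕ, q.Prime → (q : ℤ) ∣ (⟨0, 0, 0, 29720688, -180946909024⟩ : WeierstrassCurve ℤ).Δ → q ∈ L :=
    forall_mem_of_natAbs_eq_prod_pow L [14, 38, 1, 0, 1, 1] hLp (by decide +kernel)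
  have hΔF : ∀ q : ℕ, q.Prime → (q : ℤ) ∣ (⟨0, 0, 0, -659532, 206652656⟩ : WeierstrassCurve ℤ).Δ → q ∈ L :=
    forall_mem_of_natAbs_eq_prod_pow L [16, 7, 8, 0, 2, 1] hLp (by decide +kernel)
  set e := primesEquiv (R := 𝓞 ℚ) with he
  set v₀ : HeightOneSpectrum (𝓞 ℚ) := e.symm ⟨7, Fact.out⟩ with hv₀def
  have hv₀ : (e v₀ : ℕ) = 7 := by rw [hv₀def, Equiv.apply_symm_apply]
  have heqp : ∀ w : HeightOneSpectrum (𝓞 ℚ), (e w : ℕ) = 7 → w = v₀ := by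
    intro w hw
    have h1 : e w = ⟨7, Fact.out⟩ := Subtype.ext hw
    rw [hv₀def, ← h1, Equiv.symm_apply_apply]
  set S : Finset (HeightOneSpectrum (𝓞 ℚ)) :=
    (L.filterMap fun r ↦ if h : r.Prime then some (e.symm ⟨r, h⟩) else none).toFinset with hSdef
  have hmemS : ∀ w : HeightOneSpectrum (𝓞 ℚ), w ∈ S ↔ (e w : ℕ) ∈ L := by
    intro w
    rw [hSdef, List.mem_toFinset, List.mem_filterMap]
    constructor
    · rintro ⟨r, hr, hrw⟩
      by_cases hrp : r.Prime
      · rw [dif_pos hrp, Option.some.injEq] at hrw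
        rw [← hrw, Equiv.apply_symm_apply]
        exact hr
      · rw [dif_neg hrp] at hrw
        exact absurd hrw (by simp)
    · intro hw
      refine ⟨(e w : ℕ), hw, ?_⟩
      rw [dif_pos (e w).2]
      simp
  set T : Finset (HeightOneSpectrum (𝓞 ℚ)) := {v₀} with hTdef
  have hTS : T ⊆ S := by
    intro w hw
    rw [hTdef, Finset.mem_singleton] at hw
    rw [hmemS, hw, hv₀]; decide
  have hS : ∀ w : HeightOneSpectrum (𝓞 ℚ), w ∉ S →
      W.HasGoodReductionAt w ∧ F.HasGoodReductionAt w ∧ ((7 : ℕ) : 𝓞 ℚ) ∉ w.asIdeal := by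
    intro w hwS
    have hwL : (e w : ℕ) ∉ L := fun h ↦ hwS ((hmemS w).mpr h)
    have hq : (e w : ℕ).Prime := (e w).2
    refine ⟨?_, ?_, natCast_not_mem_of_primesEquiv_ne w Fact.out fun h ↦ hwL ?_⟩
    · rw [hWeq]; exact hasGoodReductionAt_mk_of_primesEquiv _ _ _ _ _ w rfl fun h ↦ hwL (hΔE _ hq h)
    · rw [hFeq]; exact hasGoodReductionAt_mk_of_primesEquiv _ _ _ _ _ w rfl fun h ↦ hwL (hΔF _ hq h)
    · show (primesEquiv w : ℕ) ∈ L
      rw [h]; decide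
  have hcardp : ∏ w ∈ T, Nat.card (w.adicCompletionIntegers ℚ ⧸
      Ideal.span {((7 : ℕ) : w.adicCompletionIntegers ℚ)}) = 7 ^ Module.finrank ℚ ℚ :=
    WeierstrassCurve.prod_natCard_quot_adicCompletionIntegers (K := ℚ) (p := 7) T fun w hw h ↦
      hw (by rw [hTdef, Finset.mem_singleton]; exact heqp w (primesEquiv_eq_of_natCast_mem Fact.out h))
  have hT : (∏ w ∈ T, Nat.card (nsmulAddMonoidHom 7 :
        (F.baseChange (w.adicCompletion ℚ)).toAffine.Point →+ _).ker *
        Nat.card (w.adicCompletionIntegers ℚ ⧸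
          Ideal.span {((7 : ℕ) : w.adicCompletionIntegers ℚ)})) < 7 ^ F.mordellWeilRank := by
    rw [Finset.prod_mul_distrib, hcardp, Module.finrank_self, hTdef, Finset.prod_singleton, h7 v₀ hv₀]
    calc (1 : ℕ) * 7 ^ 1 < 7 ^ 2 := by norm_num
      _ ≤ 7 ^ F.mordellWeilRank := Nat.pow_le_pow_right (by norm_num) hrank
  have hplaces : ∀ w ∈ S, w ∉ T →
      (((7 : ℕ) : 𝓞 ℚ) ∉ w.asIdeal ∧ Nat.card (nsmulAddMonoidHom 7 :
          (F.baseChange (w.adicCompletion ℚ)).toAffine.Point →+ _).ker = 1) ∨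
      (W.HasSplitMultiplicativeReductionAt w ∧ F.HasSplitMultiplicativeReductionAt w ∧
        Nat.card (nsmulAddMonoidHom 7 :
          (W.baseChange (w.adicCompletion ℚ)).toAffine.Point →+ _).ker ≤ 7) ∨
      (W.HasMultiplicativeReductionAt w ∧ F.HasMultiplicativeReductionAt w ∧
        (∃ r : w.adicCompletion ℚ, algebraMap ℚ (w.adicCompletion ℚ) (-(W.c₄ / W.c₆)) =
          r ^ 2 * algebraMap ℚ (w.adicCompletion ℚ) (-(F.c₄ / F.c₆))) ∧
        (∀ ζ : w.adicCompletion ℚ, ζ ^ 7 = 1 → ζ = 1)) := by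
    intro w hwS hwT
    have hwL : (e w : ℕ) ∈ L := (hmemS w).mp hwS
    have hw5 : (e w : ℕ) ≠ 7 := fun h ↦ hwT (by rw [hTdef, Finset.mem_singleton]; exact heqp w h)
    have hcases : (e w : ℕ) = 2 ∨ (e w : ℕ) = 3 ∨ (e w : ℕ) = 5 ∨ (e w : ℕ) = 11 ∨ (e w : ℕ) = 13 := by
      simp only [hL, List.mem_cons, List.mem_nil_iff, or_false] at hwL
      omega
    rcases hcases with hw | hw | hw | hw | hw
    · exact Or.inl ⟨natCast_not_mem_of_primesEquiv_ne w Fact.out hw5, h2 w hw⟩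
    · exact Or.inl ⟨natCast_not_mem_of_primesEquiv_ne w Fact.out hw5, h3 w hw⟩
    · exact Or.inl ⟨natCast_not_mem_of_primesEquiv_ne w Fact.out hw5, h5 w hw⟩
    · exact Or.inl ⟨natCast_not_mem_of_primesEquiv_ne w Fact.out hw5, h11 w hw⟩
    · exact Or.inl ⟨natCast_not_mem_of_primesEquiv_ne w Fact.out hw5, h13 w hw⟩
  exact X7RankZero.bsdp_of_casselsTate_of_congr_of_places_of_surj hCT hW hGZK hmod hU hU2 W 7 (by norm_num) hX hs hr0
    hq hv F θ hθ S T hTS hS hT hplaces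

end Summit.BirchSwinnertonDyer.Rank1Residual.Supersingular

end
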